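import Mathlib
import HarnessLib
import Summits.Ventures.LatticeQCDFlow.Scoring.CloverChargeLawSymmetric
import Summits.Ventures.LatticeQCDFlow.Exactness.OpenBoundaryTimeReflection

/-!
# The ROUNDED charge `round(α Q)`: its law is symmetric exactly when the rounding ties carry no mass, and always up to the tie mass

HONEST FRAMING: exact (Metropolis-corrected) sampling algorithms for lattice gauge theory;
figures of merit are autocorrelation/cost numbers at stated couplings and volumes; no
continuum-physics claim.

Venture `LatticeQCDFlow` (cell pub-lqcd), sub-topic `Scoring`, FANOUT row 21 (`su3-base`: the scored charge is `Q = round(α Q_L)`,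
the flowed clover charge rescaled by `α` and rounded to an integer — the `α`-rounding convention; the run check is a symmetric
histogram of the INTEGER `Q`).  OUR WORK over Mathlib and row 16's `Scoring/CloverChargeLawSymmetric` (odd observables of a
measure-preserving equivalence have symmetric laws; the Wilson-measure instance `measurePreserving_negReflect_wilsonMeasure`,
`measurable_flowedCloverCharge`, `sum_cloverPseudoscalar_wilsonFlow_negReflect` via `WilsonFlowReflectionCovariance`).  IN THE TREE
ALREADY (row 16), not restated: `Scoring/AlphaRoundedCharge` (the α-cost is continuous with a minimiser; rounding-agreement lemmas
`round_eq_round_of_integrality…`) and `Scoring/WilsonFlowRK3RoundedCharge` (the rounded RK3-flowed charge equals the rounded exactly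
flowed charge under an integrality cut).  THIS file is about the SYMMETRY of the rounded charge's law.  Def-free;
nothing is cited as a fact; no number.  The point: `round` (Mathlib: `round x = ⌊x + ½⌋`, ties rounded UP) is NOT odd —
`round(−½) = 0 ≠ −round(½)` — so the rounded charge of a symmetric `Q_L` is symmetric only up to the ties.

## What is proved (`μ` a measure on `Ω`, `e : Ω ≃ᵐ Ω` `μ`-preserving, `F` real, `e`-odd: `F ∘ e = −F`)

* §1 **`map_comp_neg_invariant_of_odd_ae`** — if a measurable `g : ℝ → ℝ` is odd OFF a measurable set `T` with `μ(F⁻¹T) = 0`, the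
  law of `g ∘ F` is symmetric about `0`; **`measure_comp_eq_le_add_of_odd_off`** — WITHOUT the null hypothesis,
  `μ{g∘F = k} ≤ μ{g∘F = −k} + μ(F⁻¹T)` for every `k` (and symmetrically): the asymmetry of the histogram is at most the tie mass.
* §2 the rounding (`round_mul_neg_of_not_tie`: odd off the half-integer ties): `measurableSet_roundTies` (`{t | ∃ m : ℤ, a·t = m + ½}` is measurable), **`map_round_neg_invariant_of_null_ties`**
  — if `μ{∃ m, a·F = m + ½} = 0` then the law of `round(a·F)` (read in `ℝ`) is symmetric; **`measure_round_eq_le_add_ties`** — in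
  general `μ{round(aF) = k} ≤ μ{round(aF) = −k} + μ{ties}`.
* §3 (`SU(n)` on `(ℤ/L)^4`, fundamental representation, every `β`, flow time `t`, `α`): **`wilsonMeasure_roundedFlowedCharge_le_add_ties`**
  — for the Wilson measure and `Q_t = Σ_x P_x ∘ V_t`, `μ{round(αQ_t) = k} ≤ μ{round(αQ_t) = −k} + μ{αQ_t ∈ ℤ + ½}` for every
  integer `k`; **`wilsonMeasure_map_roundedFlowedCharge_neg_invariant`** — symmetric law when the ties are `μ`-null.
* §4 OPEN BOUNDARY (row 21's `OpenBoundaryTimeReflection`: open direction `0`, `r`-symmetric `S`):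
  **`obcGibbs_roundedCharge_le_add_ties`** — the same tie bound for the rounded bare charge `round(αQ_S)` under the open-boundary Gibbs law.
NOT CLAIMED: that the ties ARE null for the Wilson measure (plausible — `Q_t` is real-analytic and non-constant — but not proved
here); anything about `α` itself (the minimiser of `⟨(αQ_L − round(αQ_L))²⟩`); numbers.
-/

noncomputable section

open MeasureTheory
open Literature.MathematicalPhysics.QuantumFieldTheory
open Literature.MathematicalPhysics.QuantumLattice (fundamentalRep continuous_fundamentalRep cloverPseudoscalar)

namespace Summit.Ventures.LatticeQCDFlow.Scoring

/-! ## §1 Quantizers that are odd off a null set -/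

section Abstract

variable {Ω : Type*} [MeasurableSpace Ω] {μ : Measure Ω} (e : Ω ≃ᵐ Ω)

/-- **A quantizer that is odd off a null set maps a symmetric law to a symmetric law**: `e` `μ`-preserving, `F` measurable and
`e`-odd, `g` measurable with `g(−t) = −g(t)` for `t ∉ T`, `μ(F⁻¹T) = 0` ⇒ the law of `g ∘ F` is invariant under `y ↦ −y`. -/
theorem map_comp_neg_invariant_of_odd_ae (he : MeasurePreserving e μ μ) {F : Ω → ℝ} (hFm : Measurable F)
    (hF : ∀ x, F (e x) = -F x) {g : ℝ → ℝ} (hgm : Measurable g) {T : Set ℝ}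
    (hg : ∀ t ∉ T, g (-t) = -g t) (hnull : μ (F ⁻¹' T) = 0) :
    (μ.map (fun x => g (F x))).map Neg.neg = μ.map (fun x => g (F x)) := by
  have hm : Measurable fun x => g (F x) := hgm.comp hFm
  rw [Measure.map_map measurable_neg hm]
  -- `−g(F x) = g(F (e x))` for `μ`-a.e. `x`
  have hae : (Neg.neg ∘ fun x => g (F x)) =ᵐ[μ] (fun x => g (F x)) ∘ e := by
    have hT : ∀ᵐ x ∂μ, x ∉ F ⁻¹' T := measure_eq_zero_iff_ae_notMem.1 hnull
    filter_upwards [hT] with x hx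
    simp only [Function.comp_apply, hF x]
    exact (hg (F x) hx).symm
  rw [Measure.map_congr hae, ← Measure.map_map hm e.measurable, he.map_eq]

/-- **Without the null hypothesis the asymmetry is at most the tie mass**: `μ{g∘F = k} ≤ μ{g∘F = −k} + μ(F⁻¹T)`. -/
theorem measure_comp_eq_le_add_of_odd_off (he : MeasurePreserving e μ μ) {F : Ω → ℝ} (hF : ∀ x, F (e x) = -F x)
    {g : ℝ → ℝ} {T : Set ℝ} (hg : ∀ t ∉ T, g (-t) = -g t) (k : ℝ) :
    μ {x | g (F x) = k} ≤ μ {x | g (F x) = -k} + μ (F ⁻¹' T) := by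
  -- `{g∘F = k} ⊆ e⁻¹{g∘F = −k} ∪ F⁻¹T`
  have hsub : {x | g (F x) = k} ⊆ e ⁻¹' {x | g (F x) = -k} ∪ F ⁻¹' T := by
    intro x hx
    by_cases hT : F x ∈ T
    · exact Or.inr hT
    · left
      simp only [Set.mem_preimage, Set.mem_setOf_eq, hF x, hg (F x) hT]
      rw [show g (F x) = k from hx]
  calc μ {x | g (F x) = k} ≤ μ (e ⁻¹' {x | g (F x) = -k} ∪ F ⁻¹' T) := measure_mono hsub
    _ ≤ μ (e ⁻¹' {x | g (F x) = -k}) + μ (F ⁻¹' T) := measure_union_le _ _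
    _ = μ {x | g (F x) = -k} + μ (F ⁻¹' T) := by rw [he.measure_preimage_equiv]

end Abstract

/-! ## §2 The rounding `round(a·F)` -/

section Rounding

variable {Ω : Type*} [MeasurableSpace Ω] {μ : Measure Ω} (e : Ω ≃ᵐ Ω)

/-- The rounding ties `{t | ∃ m : ℤ, a·t = m + ½}` form a measurable set. -/
theorem measurableSet_roundTies (a : ℝ) : MeasurableSet {t : ℝ | ∃ m : ℤ, a * t = m + 1 / 2} := by
  have h : {t : ℝ | ∃ m : ℤ, a * t = m + 1 / 2} = ⋃ m : ℤ, (fun t => a * t) ⁻¹' {(m : ℝ) + 1 / 2} := by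
    ext t
    simp only [Set.mem_setOf_eq, Set.mem_iUnion, Set.mem_preimage, Set.mem_singleton_iff]
  rw [h]
  exact MeasurableSet.iUnion fun m => (measurable_const_mul a) (measurableSet_singleton _)

/-- `t ↦ round(a·t)` read in `ℝ` is measurable. -/
theorem measurable_round_mul (a : ℝ) : Measurable fun t : ℝ => ((round (a * t) : ℤ) : ℝ) := by
  have h1 : Measurable fun t : ℝ => a * t + 1 / 2 := (measurable_const_mul a).add_const _
  have h2 : Measurable fun t : ℝ => ⌊a * t + 1 / 2⌋ := Int.measurable_floor.comp h1
  have h3 : Measurable fun t : ℝ => ((⌊a * t + 1 / 2⌋ : ℤ) : ℝ) := measurable_from_top.comp h2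
  have heq : (fun t : ℝ => ((round (a * t) : ℤ) : ℝ)) = fun t : ℝ => ((⌊a * t + 1 / 2⌋ : ℤ) : ℝ) := by
    funext t
    rw [round_eq]
  rw [heq]
  exact h3

/-- Off the ties the rounding is odd: `round(a·(−t)) = −round(a·t)` (`round x = ⌊x + ½⌋` rounds the ties UP, so the
half-integers must be excluded; the same six lines as the tree's `round_neg_of_ne_half_int` of another summit, inlined). -/
theorem round_mul_neg_of_not_tie (a : ℝ) {t : ℝ} (ht : t ∉ {t : ℝ | ∃ m : ℤ, a * t = m + 1 / 2}) :
    (((round (a * -t) : ℤ) : ℝ)) = -((round (a * t) : ℤ) : ℝ) := by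
  simp only [Set.mem_setOf_eq, not_exists] at ht
  have hnot : a * t - 1 / 2 ∉ Set.range (Int.cast : ℤ → ℝ) := by
    rintro ⟨m, hm⟩
    exact ht m (by linarith)
  have hround : round (-(a * t)) = -round (a * t) := by
    rw [round_eq, round_eq, show -(a * t) + 1 / 2 = -(a * t - 1 / 2) by ring, Int.floor_neg,
      (Int.ceil_eq_floor_add_one_iff_notMem _).2 hnot, show a * t + 1 / 2 = (a * t - 1 / 2) + 1 by ring, Int.floor_add_one]
  rw [mul_neg, hround, Int.cast_neg]

/-- **If the ties carry no mass, the law of the rounded observable `round(a·F)` is symmetric about `0`.** -/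
theorem map_round_neg_invariant_of_null_ties (he : MeasurePreserving e μ μ) {F : Ω → ℝ} (hFm : Measurable F)
    (hF : ∀ x, F (e x) = -F x) (a : ℝ) (hnull : μ {x | ∃ m : ℤ, a * F x = m + 1 / 2} = 0) :
    (μ.map (fun x => ((round (a * F x) : ℤ) : ℝ))).map Neg.neg = μ.map (fun x => ((round (a * F x) : ℤ) : ℝ)) :=
  map_comp_neg_invariant_of_odd_ae e he hFm hF (measurable_round_mul a) (T := {t : ℝ | ∃ m : ℤ, a * t = m + 1 / 2})
    (fun _ ht => round_mul_neg_of_not_tie a ht) hnull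

/-- **In general the asymmetry of the integer histogram is at most the tie mass**:
`μ{round(aF) = k} ≤ μ{round(aF) = −k} + μ{∃ m, aF = m + ½}` for every real (in particular integer) `k`. -/
theorem measure_round_eq_le_add_ties (he : MeasurePreserving e μ μ) {F : Ω → ℝ} (hF : ∀ x, F (e x) = -F x) (a k : ℝ) :
    μ {x | ((round (a * F x) : ℤ) : ℝ) = k} ≤
      μ {x | ((round (a * F x) : ℤ) : ℝ) = -k} + μ {x | ∃ m : ℤ, a * F x = m + 1 / 2} :=
  measure_comp_eq_le_add_of_odd_off e he hF (g := fun t => ((round (a * t) : ℤ) : ℝ))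
    (T := {t : ℝ | ∃ m : ℤ, a * t = m + 1 / 2}) (fun _ ht => round_mul_neg_of_not_tie a ht) k

end Rounding

/-! ## §3 The rounded flowed clover charge of the Wilson theory -/

section Wilson

variable {L n : ℕ} [NeZero L]

/-- **`μ_{Λ,β}{round(αQ_t) = k} ≤ μ_{Λ,β}{round(αQ_t) = −k} + μ_{Λ,β}{αQ_t ∈ ℤ + ½}`** for the flowed total clover charge
`Q_t = Σ_x P_x ∘ V_t` of `SU(n)` on `(ℤ/L)^4`, every `β`, `t`, `α`, `k` — the integer-charge histogram is symmetric up to the tie mass. -/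
theorem wilsonMeasure_roundedFlowedCharge_le_add_ties (β t α k : ℝ) :
    wilsonMeasure (fundamentalRep (Fin n)) β
        {U : GaugeConfig 4 L (Matrix.specialUnitaryGroup (Fin n) ℂ) |
          ((round (α * ∑ x : Site 4 L, cloverPseudoscalar (fundamentalRep (Fin n)) x (wilsonFlow t U)) : ℤ) : ℝ) = k} ≤
      wilsonMeasure (fundamentalRep (Fin n)) β
          {U : GaugeConfig 4 L (Matrix.specialUnitaryGroup (Fin n) ℂ) |
            ((round (α * ∑ x : Site 4 L, cloverPseudoscalar (fundamentalRep (Fin n)) x (wilsonFlow t U)) : ℤ) : ℝ) = -k} +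
        wilsonMeasure (fundamentalRep (Fin n)) β
          {U : GaugeConfig 4 L (Matrix.specialUnitaryGroup (Fin n) ℂ) |
            ∃ m : ℤ, α * ∑ x : Site 4 L, cloverPseudoscalar (fundamentalRep (Fin n)) x (wilsonFlow t U) = m + 1 / 2} :=
  measure_round_eq_le_add_ties (WilsonSiteRP.negReflectEquiv (d := 4) (L := L))
    (measurePreserving_negReflect_wilsonMeasure (fundamentalRep (Fin n)) (continuous_fundamentalRep (Fin n)) β)
    (fun U => sum_cloverPseudoscalar_wilsonFlow_negReflect t U) α k

/-- **If the rounding ties are `μ_{Λ,β}`-null, the law of the rounded flowed charge `round(αQ_t)` is symmetric about `0`.** -/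
theorem wilsonMeasure_map_roundedFlowedCharge_neg_invariant (β t α : ℝ)
    (hnull : wilsonMeasure (fundamentalRep (Fin n)) β
      {U : GaugeConfig 4 L (Matrix.specialUnitaryGroup (Fin n) ℂ) |
        ∃ m : ℤ, α * ∑ x : Site 4 L, cloverPseudoscalar (fundamentalRep (Fin n)) x (wilsonFlow t U) = m + 1 / 2} = 0) :
    ((wilsonMeasure (fundamentalRep (Fin n)) β).map
        (fun U : GaugeConfig 4 L (Matrix.specialUnitaryGroup (Fin n) ℂ) =>
          ((round (α * ∑ x : Site 4 L, cloverPseudoscalar (fundamentalRep (Fin n)) x (wilsonFlow t U)) : ℤ) : ℝ))).map Neg.neg =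
      (wilsonMeasure (fundamentalRep (Fin n)) β).map
        (fun U : GaugeConfig 4 L (Matrix.specialUnitaryGroup (Fin n) ℂ) =>
          ((round (α * ∑ x : Site 4 L, cloverPseudoscalar (fundamentalRep (Fin n)) x (wilsonFlow t U)) : ℤ) : ℝ)) :=
  map_round_neg_invariant_of_null_ties (WilsonSiteRP.negReflectEquiv (d := 4) (L := L))
    (measurePreserving_negReflect_wilsonMeasure (fundamentalRep (Fin n)) (continuous_fundamentalRep (Fin n)) β)
    (measurable_flowedCloverCharge t) (fun U => sum_cloverPseudoscalar_wilsonFlow_negReflect t U) α hnull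

end Wilson

/-! ## §4 The rounded bare charge of the open lattice (open direction `0`, `r`-symmetric sets of sites) -/

section OpenBoundary

open Summit.Ventures.LatticeQCDFlow.Exactness

variable {L N : ℕ} [NeZero L] {G : Type*} [Group G] [TopologicalSpace G] [IsTopologicalGroup G] [CompactSpace G]
  [MeasurableSpace G] [BorelSpace G] (ρ : G →* Matrix (Fin N) (Fin N) ℂ)

/-- **OPEN BOUNDARY (row 21's `OBC-HMC` arm, open direction `0`)**: for every finite set of sites `S` symmetric under the open
lattice's time reflection `r` (`x ↦ θ'x − e₀`; e.g. all sites, or the sites off the two boundary slices) and the bare charge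
`Q_S = Σ_{x∈S} P_x`, the integer histogram of `round(αQ_S)` under the open-boundary Gibbs law is symmetric up to the tie mass:
`μ{round(αQ_S) = k} ≤ μ{round(αQ_S) = −k} + μ{αQ_S ∈ ℤ + ½}` (row 21's `OpenBoundaryTimeReflection`: `R` preserves the law, `Q_S`
is `R`-odd). -/
theorem obcGibbs_roundedCharge_le_add_ties (hρ : Continuous ρ) (hρu : ∀ g, ρ g ∈ Matrix.unitaryGroup (Fin N) ℂ) (β α k : ℝ)
    {S : Finset (Site 4 L)} (hS : ∀ x ∈ S, x.negReflect - Pi.single 0 1 ∈ S) :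
    gibbsProbability (Measure.pi fun _ : Edge 4 L => haarProbability G) (fun U => Real.exp (-(β * obcAction ρ 0 U)))
        {U | ((round (α * ∑ x ∈ S, cloverPseudoscalar ρ x U) : ℤ) : ℝ) = k} ≤
      gibbsProbability (Measure.pi fun _ : Edge 4 L => haarProbability G) (fun U => Real.exp (-(β * obcAction ρ 0 U)))
          {U | ((round (α * ∑ x ∈ S, cloverPseudoscalar ρ x U) : ℤ) : ℝ) = -k} +
        gibbsProbability (Measure.pi fun _ : Edge 4 L => haarProbability G) (fun U => Real.exp (-(β * obcAction ρ 0 U)))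
          {U | ∃ m : ℤ, α * ∑ x ∈ S, cloverPseudoscalar ρ x U = m + 1 / 2} :=
  measure_round_eq_le_add_ties _ (measurePreserving_obcReflect_obcGibbs ρ hρ β)
    (fun U => sum_cloverPseudoscalar_obcReflect ρ hρu hS U) α k

end OpenBoundary

end Summit.Ventures.LatticeQCDFlow.Scoring
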